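/-
Copyright: the b2b-balaban T⁴-continuum CRUX team, row NE7b OWNER lineage `t4-ne7b-p1` (gen 136). Project licence.
-/
import Mathlib.Analysis.Complex.Exponential
import Summits.QuantumFields.BalabanUV.T4Continuum.Spine.NE7b.SupBlockEffectiveActionCovariance

/-!
# THE BLOCK STEP IS `C³` ALONG LINES — (336b)'s BLOCK TWIN: for a `C³` block potential `U : ℝ^ι → ℝ` with the block letters
# `−κ₀Σ_Yφ² ≤ U(φ)`, `‖U′(φ)‖ ≤ κ₁(a + Σ_Yφ²)`, `‖U″(φ)‖ ≤ κ₂`, `‖U‴(φ)‖ ≤ κ₃` and `Γ ⪯ γ_op·1`, `(2κ₀(1+τ)+4δ)γ_op ≤ θ < 1`, along every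
# line `ψ₀ + t·h`, `Z(t) = ∫e^{−U(ω+ψ₀+th)}dN(0,Γ)`:
#   `Z′(t₀) = ∫e^{−U}(−A)`,  `(∫e^{−U}(−A))′(t₀) = ∫e^{−U}(A² − B)`,  `(∫e^{−U}(A² − B))′(t₀) = ∫e^{−U}(−A³ + 3AB − C)`
# at EVERY `t₀` (`A = U′(u)[h]`, `B = U″(u)[h,h]`, `C = U‴(u)[h,h,h]`, `u = ω + ψ₀ + t₀h`), the last integrand integrable: the first two by
# COMPOSING (402)'s Fréchet derivatives of the step and of the tilted numerator with the line, the third by ONE scalar dominated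
# differentiation under the third block domination — the analytic half of the CUBIC LETTER of the next potential of a BLOCK-LOCAL input
# ((log Z)‴ and its tilted letters are the successor's bookkeeping, (337a) BY NAME) (row NE7b, node U5c; (399)∕(402)∕(403) BY NAME; [folklore])

Cell `pub-balaban`, sub-cell `t4`, spine estimate NE7b (`T4WeightBudget.RelWeightBound`; the cell's OWN estimate — NOT PRINTED in
[Bałaban 1983–89], NOT PROVED).  Crux-route work under `Spine/NE7b/` by the row OWNER (`t4-ne7b-p1` gen 136, file (405)) under FREEZE
(0)'s crux-prover clause, on this gen's SCOPING-d8 DECISION (d8′)(2); NOTHING of Bałaban's is named as a Lean object, valued or asserted;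
no `T4Continuum/Support` leaf typed; no `def`, no notation; zero `sorry`.  Imports (BY NAME): the OWNER's (403)
`…SupBlockEffectiveActionCovariance` (`integrable_weightedBlockHess`) and through it (402) (`hasFDerivAt_block_step`,
`hasFDerivAt_block_tiltedNumerator`), (399) (`neg_block_le`, `integrable_weighted_blockDeriv`), (313) (`sum_sq_ball_le`,
`integrable_domination`, `mul_opBound_le_of_le`), (292) (`sum_add_sq_le`); Mathlib's `hasDerivAt_integral_of_dominated_loc_of_deriv_le`,
`Real.pow_div_factorial_le_exp`.

WHAT IS PROVED ([folklore]): §1 pointwise along the line (`hasDerivAt_line`, `hasDerivAt_line_U∕U'∕U''`, `hasDerivAt_line_exp∕F1∕F2`: the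
integrands of `Z, Z′, Z″` differentiate to those of `Z′, Z″, Z‴`); §2 `cube_le_exp`, `lin_le_exp`, **`block_third_domination`**,
`norm_F3_le` (the `Z‴` integrand is under the common Gaussian dominator for `‖ψ − ψ₁‖ ≤ 1`); §3 `continuous_F2∕F3`, `integrable_F2`,
`line_ball_norm_le`, THE END **`block_line_derivs`** (the three `HasDerivAt` + integrability of the `Z‴` integrand, at every `t₀`); toy.

HONEST (what this is NOT).  Three derivatives of `Z` along a line for a block input; the quotient bookkeeping ((337a) BY NAME), the block
tilted letters bounding `(log Z)‴` and the cubic Taylor letter ((338)(A) BY NAME) are the successor's ((406)); the letters `κ₀…κ₃, a` are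
hypotheses on `U`; scalar skeleton ((A3), NC-NE7b-α UNRULED); nothing of Bałaban's asserted.  BY-NAME EFFECT ON THE WALL: NONE.  NE7b NOT
PRINTED ∕ NOT PROVED; spine PROVED 0∕9; rung (B)+1 — the programme's measures remain FINITE-torus statements; NOT the mass gap, NOT Clay.
HONEST DEPENDENCY: continuum YM on T⁴ ⇐ BetaPertH ∧ nine spine estimates (0∕9 proved); BetaPertH ⇐ (D1) ∧ (D4) ∧ CAP+tail; G-an2-4 gates
asym, D1 and NE2∕3∕4.
-/

set_option autoImplicit false
set_option maxSynthPendingDepth 2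

noncomputable section

namespace Summit.QuantumFields.BalabanUV.T4Continuum.NE7b.SupBlockStepLineDerivatives

open MeasureTheory ProbabilityTheory Finset Real Metric Filter
open scoped BigOperators Topology
open SupEffectiveActionDerivative (sum_sq_ball_le integrable_domination mul_opBound_le_of_le)
open SupRegulatedActivityShift (sum_add_sq_le)
open SupBlockEffectiveActionDerivative (neg_block_le integrable_weighted_blockDeriv)
open SupBlockEffectiveActionHessian (hasFDerivAt_block_step hasFDerivAt_block_tiltedNumerator)
open SupBlockEffectiveActionCovariance (integrable_weightedBlockHess)

variable {ι : Type} [Fintype ι] [DecidableEq ι]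

/-! ## §1. Pointwise derivatives along the line -/

section Pointwise

variable {U : EuclideanSpace ℝ ι → ℝ} {U' : EuclideanSpace ℝ ι → EuclideanSpace ℝ ι →L[ℝ] ℝ}
  {U'' : EuclideanSpace ℝ ι → EuclideanSpace ℝ ι →L[ℝ] EuclideanSpace ℝ ι →L[ℝ] ℝ}
  {U₃ : EuclideanSpace ℝ ι → EuclideanSpace ℝ ι →L[ℝ] EuclideanSpace ℝ ι →L[ℝ] EuclideanSpace ℝ ι →L[ℝ] ℝ}

omit [Fintype ι] [DecidableEq ι] in
/-- The line `t ↦ ω + (ψ₀ + t·h)` has velocity `h`. [folklore] -/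
theorem hasDerivAt_line {V : Type*} [NormedAddCommGroup V] [NormedSpace ℝ V] (ω ψ₀ h : V) (t : ℝ) :
    HasDerivAt (fun t : ℝ => ω + (ψ₀ + t • h)) h t := by
  have h1 : HasDerivAt (fun t : ℝ => t • h) ((1 : ℝ) • h) t := (hasDerivAt_id t).smul_const h
  rw [one_smul] at h1
  exact (h1.const_add ψ₀).const_add ω

omit [DecidableEq ι] in
/-- `(U(u_t))′ = U′(u_t)[h]`. [folklore] -/
theorem hasDerivAt_line_U (hUd : ∀ φ : EuclideanSpace ℝ ι, HasFDerivAt U (U' φ) φ) (ω ψ₀ h : EuclideanSpace ℝ ι) (t : ℝ) :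
    HasDerivAt (fun t : ℝ => U (ω + (ψ₀ + t • h))) (U' (ω + (ψ₀ + t • h)) h) t :=
  (hUd _).comp_hasDerivAt t (hasDerivAt_line ω ψ₀ h t)

omit [DecidableEq ι] in
/-- `(U′(u_t)[h])′ = U″(u_t)[h,h]`. [folklore] -/
theorem hasDerivAt_line_U' (hU'd : ∀ φ : EuclideanSpace ℝ ι, HasFDerivAt U' (U'' φ) φ) (ω ψ₀ h : EuclideanSpace ℝ ι) (t : ℝ) :
    HasDerivAt (fun t : ℝ => U' (ω + (ψ₀ + t • h)) h) (U'' (ω + (ψ₀ + t • h)) h h) t := by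
  have h1 : HasDerivAt (fun t : ℝ => U' (ω + (ψ₀ + t • h))) (U'' (ω + (ψ₀ + t • h)) h) t := (hU'd _).comp_hasDerivAt t (hasDerivAt_line ω ψ₀ h t)
  have h2 := h1.clm_apply (hasDerivAt_const t h)
  rw [map_zero, add_zero] at h2; exact h2

omit [DecidableEq ι] in
/-- `(U″(u_t)[h,h])′ = U‴(u_t)[h,h,h]`. [folklore] -/
theorem hasDerivAt_line_U'' (hU''d : ∀ φ : EuclideanSpace ℝ ι, HasFDerivAt U'' (U₃ φ) φ) (ω ψ₀ h : EuclideanSpace ℝ ι) (t : ℝ) :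
    HasDerivAt (fun t : ℝ => U'' (ω + (ψ₀ + t • h)) h h) (U₃ (ω + (ψ₀ + t • h)) h h h) t := by
  have h1 : HasDerivAt (fun t : ℝ => U'' (ω + (ψ₀ + t • h))) (U₃ (ω + (ψ₀ + t • h)) h) t := (hU''d _).comp_hasDerivAt t (hasDerivAt_line ω ψ₀ h t)
  have h2 := h1.clm_apply (hasDerivAt_const t h); rw [map_zero, add_zero] at h2
  have h3 := h2.clm_apply (hasDerivAt_const t h); rw [map_zero, add_zero] at h3; exact h3

omit [DecidableEq ι] in
/-- `(e^{−U(u_t)})′ = e^{−U(u_t)}·(−U′(u_t)[h])`. [folklore] -/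
theorem hasDerivAt_line_exp (hUd : ∀ φ : EuclideanSpace ℝ ι, HasFDerivAt U (U' φ) φ) (ω ψ₀ h : EuclideanSpace ℝ ι) (t : ℝ) :
    HasDerivAt (fun t : ℝ => exp (-U (ω + (ψ₀ + t • h)))) (exp (-U (ω + (ψ₀ + t • h))) * -(U' (ω + (ψ₀ + t • h)) h)) t :=
  (hasDerivAt_line_U hUd ω ψ₀ h t).fun_neg.exp

omit [DecidableEq ι] in
/-- **`(e^{−U}(−A))′ = e^{−U}(A·A − B)`** — the integrand of `Z″`. [folklore] -/
theorem hasDerivAt_line_F1 (hUd : ∀ φ : EuclideanSpace ℝ ι, HasFDerivAt U (U' φ) φ)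
    (hU'd : ∀ φ : EuclideanSpace ℝ ι, HasFDerivAt U' (U'' φ) φ) (ω ψ₀ h : EuclideanSpace ℝ ι) (t : ℝ) :
    HasDerivAt (fun t : ℝ => exp (-U (ω + (ψ₀ + t • h))) * -(U' (ω + (ψ₀ + t • h)) h))
      (exp (-U (ω + (ψ₀ + t • h))) * (U' (ω + (ψ₀ + t • h)) h * U' (ω + (ψ₀ + t • h)) h - U'' (ω + (ψ₀ + t • h)) h h)) t :=
  ((hasDerivAt_line_exp hUd ω ψ₀ h t).mul (hasDerivAt_line_U' hU'd ω ψ₀ h t).fun_neg).congr_deriv (by ring)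

omit [DecidableEq ι] in
/-- **`(e^{−U}(A·A − B))′ = e^{−U}(−A·A·A + 3AB − C)`** — the integrand of `Z‴`. [folklore] -/
theorem hasDerivAt_line_F2 (hUd : ∀ φ : EuclideanSpace ℝ ι, HasFDerivAt U (U' φ) φ) (hU'd : ∀ φ : EuclideanSpace ℝ ι, HasFDerivAt U' (U'' φ) φ)
    (hU''d : ∀ φ : EuclideanSpace ℝ ι, HasFDerivAt U'' (U₃ φ) φ) (ω ψ₀ h : EuclideanSpace ℝ ι) (t : ℝ) :
    HasDerivAt (fun t : ℝ => exp (-U (ω + (ψ₀ + t • h))) * (U' (ω + (ψ₀ + t • h)) h * U' (ω + (ψ₀ + t • h)) h - U'' (ω + (ψ₀ + t • h)) h h))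
      (exp (-U (ω + (ψ₀ + t • h))) * (-(U' (ω + (ψ₀ + t • h)) h * U' (ω + (ψ₀ + t • h)) h * U' (ω + (ψ₀ + t • h)) h) + 3 * U' (ω + (ψ₀ + t • h)) h * U'' (ω + (ψ₀ + t • h))
          h h - U₃ (ω + (ψ₀ + t • h)) h h h)) t :=
  ((hasDerivAt_line_exp hUd ω ψ₀ h t).mul (((hasDerivAt_line_U' hU'd ω ψ₀ h t).mul (hasDerivAt_line_U' hU'd ω ψ₀ h t)).sub
    (hasDerivAt_line_U'' hU''d ω ψ₀ h t))).congr_deriv (by simp only [Pi.mul_apply, Pi.sub_apply]; ring)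

end Pointwise

/-! ## §2. The third block domination -/

/-- `S³ ≤ (δ³)⁻¹·e^{2δS}` for `δ > 0`, `S ≥ 0` (from `x³∕3! ≤ eˣ`). [folklore] -/
theorem cube_le_exp {δ S : ℝ} (hδ : 0 < δ) (hS : 0 ≤ S) : S ^ 3 ≤ (δ ^ 3)⁻¹ * exp (2 * δ * S) := by
  have h := Real.pow_div_factorial_le_exp (x := 2 * δ * S) (by positivity) 3
  have e3 : ((Nat.factorial 3 : ℕ) : ℝ) = 6 := by norm_num [Nat.factorial]
  rw [e3] at h
  have h1 : δ ^ 3 * S ^ 3 ≤ exp (2 * δ * S) := by nlinarith [pow_nonneg hδ.le 3, pow_nonneg hS 3]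
  rw [le_inv_mul_iff₀' (pow_pos hδ 3), mul_comm]; exact h1

/-- `2S ≤ δ⁻¹·e^{2δS}` for `δ > 0`. [folklore] -/
theorem lin_le_exp {δ : ℝ} (hδ : 0 < δ) (S : ℝ) : 2 * S ≤ δ⁻¹ * exp (2 * δ * S) := by
  rw [le_inv_mul_iff₀' hδ]; linarith [add_one_le_exp (2 * δ * S)]

section Domination

variable {U : EuclideanSpace ℝ ι → ℝ} {U' : EuclideanSpace ℝ ι → EuclideanSpace ℝ ι →L[ℝ] ℝ}
  {U'' : EuclideanSpace ℝ ι → EuclideanSpace ℝ ι →L[ℝ] EuclideanSpace ℝ ι →L[ℝ] ℝ}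
  {U₃ : EuclideanSpace ℝ ι → EuclideanSpace ℝ ι →L[ℝ] EuclideanSpace ℝ ι →L[ℝ] EuclideanSpace ℝ ι →L[ℝ] ℝ} {κ₀ κ₁ κ₂ κ₃ a τ δ : ℝ}
set_option maxHeartbeats 400000 in
omit [DecidableEq ι] in
/-- **THE THIRD BLOCK DOMINATION**: stability (`κ₀ ≥ 0`), gradient letter (`κ₁, a ≥ 0`), `κ₂, κ₃ ≥ 0`, `0 < τ`, `0 < δ`; for `‖ψ − ψ₁‖ ≤ 1`
and every `ω`, with `M = 2Σ_Yψ₁² + 2`: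
`e^{−U(ω+ψ)}·‖h‖³(‖U′(ω+ψ)‖³ + 3κ₂‖U′(ω+ψ)‖ + κ₃) ≤ ‖h‖³e^{κ₀(1+τ⁻¹)M}(κ₁³(4(a+2M)³ + 32(δ³)⁻¹) + 3κ₂κ₁((a+2M) + δ⁻¹) + κ₃)·e^{½(2κ₀(1+τ)+4δ)Σ_Yω²}`.
[folklore] -/
theorem block_third_domination (Y : Finset ι) (hκ₀ : 0 ≤ κ₀) (hκ₁ : 0 ≤ κ₁) (ha : 0 ≤ a) (hκ₂ : 0 ≤ κ₂) (hκ₃ : 0 ≤ κ₃) (hτ : 0 < τ)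
    (hδ : 0 < δ) (hstab : ∀ φ : EuclideanSpace ℝ ι, -(κ₀ * ∑ x ∈ Y, φ x ^ 2) ≤ U φ)
    (hU'b : ∀ φ : EuclideanSpace ℝ ι, ‖U' φ‖ ≤ κ₁ * (a + ∑ x ∈ Y, φ x ^ 2)) (ψ₁ ψ : EuclideanSpace ℝ ι) (hψ : ‖ψ - ψ₁‖ ≤ 1)
    (ω h : EuclideanSpace ℝ ι) :
    exp (-U (ω + ψ)) * (‖h‖ ^ 3 * (‖U' (ω + ψ)‖ ^ 3 + 3 * κ₂ * ‖U' (ω + ψ)‖ + κ₃)) ≤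
      (‖h‖ ^ 3 * exp (κ₀ * (1 + τ⁻¹) * (2 * ∑ x ∈ Y, ψ₁ x ^ 2 + 2)) * (κ₁ ^ 3 * (4 * (a + 2 * (2 * ∑ x ∈ Y, ψ₁ x ^ 2 + 2)) ^ 3 + 32 * (δ ^ 3)⁻¹) + 3 * κ₂ * κ₁ * ((a + 2 *
          (2 * ∑ x ∈ Y, ψ₁ x ^ 2 + 2)) + δ⁻¹) + κ₃)) *
        exp ((2 * κ₀ * (1 + τ) + 4 * δ) * (∑ x ∈ Y, ω x ^ 2) / 2) := by
  set M : ℝ := (2 * ∑ x ∈ Y, ψ₁ x ^ 2 + 2) with hM; set Sω : ℝ := ∑ x ∈ Y, ω x ^ 2 with hSω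
  have hSω0 : 0 ≤ Sω := sum_nonneg fun x _ => sq_nonneg _; have hM0 : 0 ≤ M := by rw [hM]; positivity
  have hψM : ∑ x ∈ Y, ψ x ^ 2 ≤ M := sum_sq_ball_le Y hψ
  set c : ℝ := a + 2 * M with hc; have hc0 : 0 ≤ c := by rw [hc]; positivity
  -- the exponent: stability + Young
  have hV : -U (ω + ψ) ≤ κ₀ * (1 + τ) * Sω + κ₀ * (1 + τ⁻¹) * M := by
    have h := neg_block_le Y hκ₀ hτ hstab ω ψ
    have h2 : κ₀ * (1 + τ⁻¹) * ∑ x ∈ Y, ψ x ^ 2 ≤ κ₀ * (1 + τ⁻¹) * M := mul_le_mul_of_nonneg_left hψM (by positivity)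
    linarith
  -- the gradient: `‖U′(ω+ψ)‖ ≤ κ₁(c + 2Σω²)`
  have hsum : ∑ x ∈ Y, (ω + ψ) x ^ 2 ≤ 2 * Sω + 2 * M := by
    have h := sum_add_sq_le Y (fun x => ω x) (fun x => ψ x) one_pos
    have e : ∑ x ∈ Y, (ω + ψ) x ^ 2 = ∑ x ∈ Y, (ω x + ψ x) ^ 2 := sum_congr rfl fun x _ => by simp
    rw [e]; norm_num at h; linarith
  set q : ℝ := c + 2 * Sω with hq; have hq0 : 0 ≤ q := by rw [hq]; positivity
  have hD : ‖U' (ω + ψ)‖ ≤ κ₁ * q := by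
    refine (hU'b (ω + ψ)).trans (mul_le_mul_of_nonneg_left ?_ hκ₁)
    rw [hq, hc]; linarith
  -- the polynomial prefactor under one exponential
  have he1 : 1 ≤ exp (2 * δ * Sω) := one_le_exp_iff.2 (by positivity)
  have hq1 : q ≤ (c + δ⁻¹) * exp (2 * δ * Sω) := by
    have h3 := lin_le_exp hδ Sω
    have h4 : c ≤ c * exp (2 * δ * Sω) := le_mul_of_one_le_right hc0 he1
    rw [hq]; nlinarith
  have hq3 : q ^ 3 ≤ (4 * c ^ 3 + 32 * (δ ^ 3)⁻¹) * exp (2 * δ * Sω) := by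
    have h1 : (c + 2 * Sω) ^ 3 ≤ 4 * (c ^ 3 + (2 * Sω) ^ 3) := by   -- `(p+q)³ ≤ 4(p³+q³)` (the tree's `add_pow_three_le`, inlined)
      nlinarith [mul_nonneg (add_nonneg hc0 (show 0 ≤ 2 * Sω by positivity)) (sq_nonneg (c - 2 * Sω)), mul_nonneg hc0 hSω0]
    have h2 := cube_le_exp hδ hSω0
    have h4 : c ^ 3 ≤ c ^ 3 * exp (2 * δ * Sω) := le_mul_of_one_le_right (pow_nonneg hc0 3) he1
    have e8 : (2 * Sω) ^ 3 = 8 * Sω ^ 3 := by ring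
    rw [e8] at h1; rw [hq]; nlinarith [pow_nonneg hc0 3]
  have hpoly : ‖U' (ω + ψ)‖ ^ 3 + 3 * κ₂ * ‖U' (ω + ψ)‖ + κ₃ ≤
      (κ₁ ^ 3 * (4 * c ^ 3 + 32 * (δ ^ 3)⁻¹) + 3 * κ₂ * κ₁ * (c + δ⁻¹) + κ₃) * exp (2 * δ * Sω) := by
    have h1 : ‖U' (ω + ψ)‖ ^ 3 ≤ (κ₁ * q) ^ 3 := pow_le_pow_left₀ (norm_nonneg _) hD 3
    have h2 : (κ₁ * q) ^ 3 ≤ κ₁ ^ 3 * ((4 * c ^ 3 + 32 * (δ ^ 3)⁻¹) * exp (2 * δ * Sω)) := by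
      rw [mul_pow]; exact mul_le_mul_of_nonneg_left hq3 (pow_nonneg hκ₁ 3)
    have h3 : 3 * κ₂ * ‖U' (ω + ψ)‖ ≤ 3 * κ₂ * (κ₁ * ((c + δ⁻¹) * exp (2 * δ * Sω))) :=
      mul_le_mul_of_nonneg_left (hD.trans (mul_le_mul_of_nonneg_left hq1 hκ₁)) (by positivity)
    have h5 : κ₃ ≤ κ₃ * exp (2 * δ * Sω) := le_mul_of_one_le_right hκ₃ he1
    nlinarith
  have hK0 : 0 ≤ κ₁ ^ 3 * (4 * c ^ 3 + 32 * (δ ^ 3)⁻¹) + 3 * κ₂ * κ₁ * (c + δ⁻¹) + κ₃ := by positivity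
  calc exp (-U (ω + ψ)) * (‖h‖ ^ 3 * (‖U' (ω + ψ)‖ ^ 3 + 3 * κ₂ * ‖U' (ω + ψ)‖ + κ₃))
      ≤ exp (κ₀ * (1 + τ) * Sω + κ₀ * (1 + τ⁻¹) * M) *
          (‖h‖ ^ 3 * ((κ₁ ^ 3 * (4 * c ^ 3 + 32 * (δ ^ 3)⁻¹) + 3 * κ₂ * κ₁ * (c + δ⁻¹) + κ₃) * exp (2 * δ * Sω))) :=
        mul_le_mul (exp_le_exp.2 hV) (mul_le_mul_of_nonneg_left hpoly (pow_nonneg (norm_nonneg _) 3)) (by positivity) (exp_pos _).le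
    _ = (‖h‖ ^ 3 * exp (κ₀ * (1 + τ⁻¹) * M) * (κ₁ ^ 3 * (4 * c ^ 3 + 32 * (δ ^ 3)⁻¹) + 3 * κ₂ * κ₁ * (c + δ⁻¹) + κ₃)) *
          exp ((2 * κ₀ * (1 + τ) + 4 * δ) * Sω / 2) := by
        have he : exp (κ₀ * (1 + τ) * Sω + κ₀ * (1 + τ⁻¹) * M) * exp (2 * δ * Sω) =
            exp (κ₀ * (1 + τ⁻¹) * M) * exp ((2 * κ₀ * (1 + τ) + 4 * δ) * Sω / 2) := by
          rw [← exp_add, ← exp_add]; congr 1; ring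
        calc exp (κ₀ * (1 + τ) * Sω + κ₀ * (1 + τ⁻¹) * M) *
              (‖h‖ ^ 3 * ((κ₁ ^ 3 * (4 * c ^ 3 + 32 * (δ ^ 3)⁻¹) + 3 * κ₂ * κ₁ * (c + δ⁻¹) + κ₃) * exp (2 * δ * Sω)))
            = ‖h‖ ^ 3 * (κ₁ ^ 3 * (4 * c ^ 3 + 32 * (δ ^ 3)⁻¹) + 3 * κ₂ * κ₁ * (c + δ⁻¹) + κ₃) *
                (exp (κ₀ * (1 + τ) * Sω + κ₀ * (1 + τ⁻¹) * M) * exp (2 * δ * Sω)) := by ring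
          _ = _ := by rw [he]; ring

omit [DecidableEq ι] in
/-- **The `Z‴` integrand is under the third domination**: with `‖U″‖ ≤ κ₂`, `‖U‴‖ ≤ κ₃`,
`|e^{−U}(−A³ + 3AB − C)| ≤ e^{−U}‖h‖³(‖U′‖³ + 3κ₂‖U′‖ + κ₃)`. [folklore] -/
theorem norm_F3_le (hU''b : ∀ φ : EuclideanSpace ℝ ι, ‖U'' φ‖ ≤ κ₂)
    (hU₃b : ∀ φ : EuclideanSpace ℝ ι, ‖U₃ φ‖ ≤ κ₃) (ω ψ h : EuclideanSpace ℝ ι) :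
    ‖exp (-U (ω + ψ)) * (-(U' (ω + ψ) h * U' (ω + ψ) h * U' (ω + ψ) h) + 3 * U' (ω + ψ) h * U'' (ω + ψ) h h - U₃ (ω + ψ) h h h)‖ ≤
      exp (-U (ω + ψ)) * (‖h‖ ^ 3 * (‖U' (ω + ψ)‖ ^ 3 + 3 * κ₂ * ‖U' (ω + ψ)‖ + κ₃)) := by
  have hA : |U' (ω + ψ) h| ≤ ‖U' (ω + ψ)‖ * ‖h‖ := by
    rw [← Real.norm_eq_abs]; exact ContinuousLinearMap.le_opNorm _ _
  have hB : |U'' (ω + ψ) h h| ≤ κ₂ * ‖h‖ ^ 2 := by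
    rw [← Real.norm_eq_abs]
    calc ‖U'' (ω + ψ) h h‖ ≤ ‖U'' (ω + ψ)‖ * ‖h‖ * ‖h‖ := ContinuousLinearMap.le_opNorm₂ _ _ _
      _ ≤ κ₂ * ‖h‖ * ‖h‖ := by gcongr; exact hU''b _
      _ = κ₂ * ‖h‖ ^ 2 := by ring
  have hC : |U₃ (ω + ψ) h h h| ≤ κ₃ * ‖h‖ ^ 3 := by
    rw [← Real.norm_eq_abs]
    have hκ₃ : 0 ≤ κ₃ := (norm_nonneg (U₃ (ω + ψ))).trans (hU₃b (ω + ψ))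
    calc ‖U₃ (ω + ψ) h h h‖ ≤ ‖U₃ (ω + ψ) h‖ * ‖h‖ * ‖h‖ := ContinuousLinearMap.le_opNorm₂ _ _ _
      _ ≤ ‖U₃ (ω + ψ)‖ * ‖h‖ * ‖h‖ * ‖h‖ := by gcongr; exact ContinuousLinearMap.le_opNorm _ _
      _ ≤ κ₃ * ‖h‖ * ‖h‖ * ‖h‖ := by gcongr; exact hU₃b _
      _ = κ₃ * ‖h‖ ^ 3 := by ring
  set A : ℝ := U' (ω + ψ) h; set B : ℝ := U'' (ω + ψ) h h; set C : ℝ := U₃ (ω + ψ) h h h; set n : ℝ := ‖U' (ω + ψ)‖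
  have hn : 0 ≤ n := norm_nonneg _; have hh : 0 ≤ ‖h‖ := norm_nonneg _
  rw [norm_mul, Real.norm_eq_abs, abs_of_pos (exp_pos _), Real.norm_eq_abs]
  refine mul_le_mul_of_nonneg_left ?_ (exp_pos _).le
  have h3 : |A| ^ 3 ≤ (n * ‖h‖) ^ 3 := pow_le_pow_left₀ (abs_nonneg _) hA 3
  have hAB : |A| * |B| ≤ n * ‖h‖ * (κ₂ * ‖h‖ ^ 2) := mul_le_mul hA hB (abs_nonneg _) (by positivity)
  calc |-(A * A * A) + 3 * A * B - C| ≤ |-(A * A * A) + 3 * A * B| + |C| := abs_sub _ _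
    _ ≤ |-(A * A * A)| + |3 * A * B| + |C| := by linarith [abs_add_le (-(A * A * A)) (3 * A * B)]
    _ = |A| ^ 3 + 3 * (|A| * |B|) + |C| := by
        simp only [abs_neg, abs_mul, abs_of_pos (by norm_num : (0 : ℝ) < 3)]; ring
    _ ≤ (n * ‖h‖) ^ 3 + 3 * (n * ‖h‖ * (κ₂ * ‖h‖ ^ 2)) + κ₃ * ‖h‖ ^ 3 := by linarith
    _ = ‖h‖ ^ 3 * (n ^ 3 + 3 * κ₂ * n + κ₃) := by ring

end Domination

/-! ## §3. THE END: `Z`, `Z′`, `Z″` along the line are differentiable -/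

section Main

variable {Γ : Matrix ι ι ℝ} {γop : ℝ} {U : EuclideanSpace ℝ ι → ℝ} {U' : EuclideanSpace ℝ ι → EuclideanSpace ℝ ι →L[ℝ] ℝ}
  {U'' : EuclideanSpace ℝ ι → EuclideanSpace ℝ ι →L[ℝ] EuclideanSpace ℝ ι →L[ℝ] ℝ}
  {U₃ : EuclideanSpace ℝ ι → EuclideanSpace ℝ ι →L[ℝ] EuclideanSpace ℝ ι →L[ℝ] EuclideanSpace ℝ ι →L[ℝ] ℝ} {κ₀ κ₁ κ₂ κ₃ a τ δ θ : ℝ}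

omit [DecidableEq ι] in
/-- The `Z″` integrand is continuous in `ω` (`U, U′, U″` continuous). [folklore] -/
theorem continuous_F2 (hUd : ∀ φ : EuclideanSpace ℝ ι, HasFDerivAt U (U' φ) φ)
    (hU'd : ∀ φ : EuclideanSpace ℝ ι, HasFDerivAt U' (U'' φ) φ) (hU''c : Continuous U'') (ψ h : EuclideanSpace ℝ ι) :
    Continuous fun ω : EuclideanSpace ℝ ι => exp (-U (ω + ψ)) * (U' (ω + ψ) h * U' (ω + ψ) h - U'' (ω + ψ) h h) := by
  have hUc : Continuous U := continuous_iff_continuousAt.2 fun φ => (hUd φ).continuousAt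
  have hU'c : Continuous U' := continuous_iff_continuousAt.2 fun φ => (hU'd φ).continuousAt
  have hsh : Continuous fun ω : EuclideanSpace ℝ ι => ω + ψ := continuous_id.add continuous_const
  have hA : Continuous fun ω : EuclideanSpace ℝ ι => U' (ω + ψ) h := (hU'c.comp hsh).clm_apply continuous_const
  have hB : Continuous fun ω : EuclideanSpace ℝ ι => U'' (ω + ψ) h h :=
    ((hU''c.comp hsh).clm_apply continuous_const).clm_apply continuous_const
  exact (continuous_exp.comp ((hUc.comp hsh).neg)).mul ((hA.mul hA).sub hB)

omit [DecidableEq ι] in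
/-- The `Z‴` integrand is continuous in `ω` (`U, U′, U″, U‴` continuous). [folklore] -/
theorem continuous_F3 (hUd : ∀ φ : EuclideanSpace ℝ ι, HasFDerivAt U (U' φ) φ) (hU'd : ∀ φ : EuclideanSpace ℝ ι, HasFDerivAt U' (U'' φ) φ)
    (hU''d : ∀ φ : EuclideanSpace ℝ ι, HasFDerivAt U'' (U₃ φ) φ) (hU₃c : Continuous U₃) (ψ h : EuclideanSpace ℝ ι) :
    Continuous fun ω : EuclideanSpace ℝ ι => exp (-U (ω + ψ)) * (-(U' (ω + ψ) h * U' (ω + ψ) h * U' (ω + ψ) h) + 3 * U' (ω + ψ) h * U'' (ω + ψ) h h - U₃ (ω + ψ) h h h) :=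
        by
  have hUc : Continuous U := continuous_iff_continuousAt.2 fun φ => (hUd φ).continuousAt
  have hU'c : Continuous U' := continuous_iff_continuousAt.2 fun φ => (hU'd φ).continuousAt; have hU''c : Continuous U'' :=
    continuous_iff_continuousAt.2 fun φ => (hU''d φ).continuousAt
  have hsh : Continuous fun ω : EuclideanSpace ℝ ι => ω + ψ := continuous_id.add continuous_const
  have hA : Continuous fun ω : EuclideanSpace ℝ ι => U' (ω + ψ) h := (hU'c.comp hsh).clm_apply continuous_const
  have hB : Continuous fun ω : EuclideanSpace ℝ ι => U'' (ω + ψ) h h :=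
    ((hU''c.comp hsh).clm_apply continuous_const).clm_apply continuous_const
  have hC : Continuous fun ω : EuclideanSpace ℝ ι => U₃ (ω + ψ) h h h :=
    (((hU₃c.comp hsh).clm_apply continuous_const).clm_apply continuous_const).clm_apply continuous_const
  exact (continuous_exp.comp ((hUc.comp hsh).neg)).mul ((((hA.mul hA).mul hA).neg.add ((continuous_const.mul hA).mul hB)).sub hC)

/-- **The `Z″` integrand is integrable** at every external field ((403)'s Bochner integrability applied to `h, h`). [folklore] -/
theorem integrable_F2 (hΓ : Γ.PosSemidef) (hΓop : (γop • (1 : Matrix ι ι ℝ) - Γ).PosSemidef) (Y : Finset ι)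
    (hUd : ∀ φ : EuclideanSpace ℝ ι, HasFDerivAt U (U' φ) φ) (hU'd : ∀ φ : EuclideanSpace ℝ ι, HasFDerivAt U' (U'' φ) φ)
    (hU''c : Continuous U'') (hκ₀ : 0 ≤ κ₀) (hκ₁ : 0 ≤ κ₁) (ha : 0 ≤ a) (hκ₂ : 0 ≤ κ₂) (hτ : 0 < τ) (hδ : 0 < δ) (hθ1 : θ < 1)
    (hκθ : (2 * κ₀ * (1 + τ) + 4 * δ) * γop ≤ θ) (hstab : ∀ φ : EuclideanSpace ℝ ι, -(κ₀ * ∑ x ∈ Y, φ x ^ 2) ≤ U φ)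
    (hU'b : ∀ φ : EuclideanSpace ℝ ι, ‖U' φ‖ ≤ κ₁ * (a + ∑ x ∈ Y, φ x ^ 2)) (hU''b : ∀ φ : EuclideanSpace ℝ ι, ‖U'' φ‖ ≤ κ₂)
    (ψ h : EuclideanSpace ℝ ι) :
    Integrable (fun ω : EuclideanSpace ℝ ι => exp (-U (ω + ψ)) * (U' (ω + ψ) h * U' (ω + ψ) h - U'' (ω + ψ) h h)) (multivariateGaussian 0 Γ) := by
  have hI := ((integrable_weightedBlockHess hΓ hΓop Y hUd hU'd hU''c hκ₀ hκ₁ ha hκ₂ hτ hδ hθ1 hκθ hstab hU'b hU''b ψ).apply_continuousLinearMap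
    h).apply_continuousLinearMap h
  refine hI.neg.congr (ae_of_all _ fun ω => ?_)
  simp only [Pi.neg_apply, _root_.smul_apply, _root_.sub_apply, ContinuousLinearMap.smulRight_apply, smul_eq_mul]
  ring

omit [Fintype ι] [DecidableEq ι] in
/-- On the ball of radius `(1 + ‖h‖)⁻¹` about `t₀` the line stays within distance `1` of `ψ₀ + t₀h`. [folklore] -/
theorem line_ball_norm_le {V : Type*} [NormedAddCommGroup V] [NormedSpace ℝ V] (ψ₀ h : V) {t₀ t : ℝ}
    (ht : t ∈ closedBall t₀ (1 + ‖h‖)⁻¹) : ‖(ψ₀ + t • h) - (ψ₀ + t₀ • h)‖ ≤ 1 := by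
  rw [mem_closedBall, dist_eq_norm, Real.norm_eq_abs] at ht
  have hh : 0 ≤ ‖h‖ := norm_nonneg _
  have e : (ψ₀ + t • h) - (ψ₀ + t₀ • h) = (t - t₀) • h := by rw [sub_smul]; abel
  rw [e, norm_smul, Real.norm_eq_abs]
  calc |t - t₀| * ‖h‖ ≤ (1 + ‖h‖)⁻¹ * ‖h‖ := mul_le_mul_of_nonneg_right ht hh
    _ ≤ 1 := by rw [inv_mul_le_iff₀ (by positivity)]; linarith

/-- **THE END — THE BLOCK STEP IS `C³` ALONG LINES.**  `Γ ⪰ 0`, `Γ ⪯ γ_op·1`; a `C³` block potential `U` (`U′, U″, U‴` its successive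
Fréchet derivatives, `U‴` continuous) with the block letters `−κ₀Σ_Yφ² ≤ U(φ)`, `‖U′(φ)‖ ≤ κ₁(a + Σ_Yφ²)`, `‖U″(φ)‖ ≤ κ₂`, `‖U‴(φ)‖ ≤ κ₃`
(`κ₀, κ₁, κ₂, κ₃, a ≥ 0`); `0 < τ, δ`, `0 < θ < 1`, `(2κ₀(1+τ)+4δ)γ_op ≤ θ`.  Then along every line `ψ₀ + t·h`, at EVERY `t₀`: the `Z‴`
integrand is integrable and
`Z′(t₀) = ∫e^{−U}(−A)`, `(∫e^{−U}(−A))′(t₀) = ∫e^{−U}(A·A − B)`, `(∫e^{−U}(A·A − B))′(t₀) = ∫e^{−U}(−A·A·A + 3AB − C)` (all over `N(0,Γ)`,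
`A = U′(u)[h]`, `B = U″(u)[h,h]`, `C = U‴(u)[h,h,h]`, `u = ω + ψ₀ + th`). [folklore] -/
theorem block_line_derivs (hΓ : Γ.PosSemidef) (hΓop : (γop • (1 : Matrix ι ι ℝ) - Γ).PosSemidef) (Y : Finset ι)
    (hUd : ∀ φ : EuclideanSpace ℝ ι, HasFDerivAt U (U' φ) φ) (hU'd : ∀ φ : EuclideanSpace ℝ ι, HasFDerivAt U' (U'' φ) φ)
    (hU''d : ∀ φ : EuclideanSpace ℝ ι, HasFDerivAt U'' (U₃ φ) φ) (hU₃c : Continuous U₃)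
    (hκ₀ : 0 ≤ κ₀) (hκ₁ : 0 ≤ κ₁) (ha : 0 ≤ a) (hκ₂ : 0 ≤ κ₂) (hκ₃ : 0 ≤ κ₃) (hτ : 0 < τ) (hδ : 0 < δ) (hθ0 : 0 < θ) (hθ1 : θ < 1)
    (hκθ : (2 * κ₀ * (1 + τ) + 4 * δ) * γop ≤ θ) (hstab : ∀ φ : EuclideanSpace ℝ ι, -(κ₀ * ∑ x ∈ Y, φ x ^ 2) ≤ U φ)
    (hU'b : ∀ φ : EuclideanSpace ℝ ι, ‖U' φ‖ ≤ κ₁ * (a + ∑ x ∈ Y, φ x ^ 2)) (hU''b : ∀ φ : EuclideanSpace ℝ ι, ‖U'' φ‖ ≤ κ₂)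
    (hU₃b : ∀ φ : EuclideanSpace ℝ ι, ‖U₃ φ‖ ≤ κ₃) (ψ₀ h : EuclideanSpace ℝ ι) (t₀ : ℝ) :
    Integrable (fun ω : EuclideanSpace ℝ ι => exp (-U (ω + (ψ₀ + t₀ • h))) * (-(U' (ω + (ψ₀ + t₀ • h)) h * U' (ω + (ψ₀ + t₀ • h)) h * U' (ω + (ψ₀ + t₀ • h)) h) + 3 * U' (ω
        + (ψ₀ + t₀ • h)) h * U'' (ω + (ψ₀ + t₀ • h)) h h - U₃ (ω + (ψ₀ + t₀ • h)) h h h)) (multivariateGaussian 0 Γ) ∧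
      HasDerivAt (fun t : ℝ => ∫ ω : EuclideanSpace ℝ ι, exp (-U (ω + (ψ₀ + t • h))) ∂(multivariateGaussian 0 Γ))
        (∫ ω : EuclideanSpace ℝ ι, exp (-U (ω + (ψ₀ + t₀ • h))) * -(U' (ω + (ψ₀ + t₀ • h)) h) ∂(multivariateGaussian 0 Γ)) t₀ ∧
      HasDerivAt (fun t : ℝ => ∫ ω : EuclideanSpace ℝ ι, exp (-U (ω + (ψ₀ + t • h))) * -(U' (ω + (ψ₀ + t • h)) h) ∂(multivariateGaussian 0 Γ))
        (∫ ω : EuclideanSpace ℝ ι, exp (-U (ω + (ψ₀ + t₀ • h))) * (U' (ω + (ψ₀ + t₀ • h)) h * U' (ω + (ψ₀ + t₀ • h)) h - U'' (ω + (ψ₀ + t₀ • h)) h h) ∂(multivariateGaussian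
            0 Γ)) t₀ ∧
      HasDerivAt (fun t : ℝ => ∫ ω : EuclideanSpace ℝ ι, exp (-U (ω + (ψ₀ + t • h))) * (U' (ω + (ψ₀ + t • h)) h * U' (ω + (ψ₀ + t • h)) h - U'' (ω + (ψ₀ + t • h)) h h)
          ∂(multivariateGaussian 0 Γ))
        (∫ ω : EuclideanSpace ℝ ι, exp (-U (ω + (ψ₀ + t₀ • h))) * (-(U' (ω + (ψ₀ + t₀ • h)) h * U' (ω + (ψ₀ + t₀ • h)) h * U' (ω + (ψ₀ + t₀ • h)) h) + 3 * U' (ω + (ψ₀ + t₀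
            • h)) h * U'' (ω + (ψ₀ + t₀ • h)) h h - U₃ (ω + (ψ₀ + t₀ • h)) h h h) ∂(multivariateGaussian 0 Γ)) t₀ := by
  have hU'c : Continuous U' := continuous_iff_continuousAt.2 fun φ => (hU'd φ).continuousAt
  have hU''c : Continuous U'' := continuous_iff_continuousAt.2 fun φ => (hU''d φ).continuousAt
  have hℓ : ∀ t : ℝ, HasDerivAt (fun t : ℝ => ψ₀ + t • h) h t := fun t => by
    have h0 := hasDerivAt_line (0 : EuclideanSpace ℝ ι) ψ₀ h t; simp only [zero_add] at h0; exact h0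
  -- the first-order tilted integral applied to `h`, at every point of the line
  have idG : ∀ t : ℝ, (∫ ω : EuclideanSpace ℝ ι, exp (-U (ω + (ψ₀ + t • h))) • U' (ω + (ψ₀ + t • h)) ∂(multivariateGaussian 0 Γ)) h =
      ∫ ω : EuclideanSpace ℝ ι, exp (-U (ω + (ψ₀ + t • h))) * U' (ω + (ψ₀ + t • h)) h ∂(multivariateGaussian 0 Γ) := fun t => by
    rw [ContinuousLinearMap.integral_apply
      (integrable_weighted_blockDeriv hΓ hΓop Y hUd hU'c hκ₀ hκ₁ ha hτ hδ hθ1 hκθ hstab hU'b (ψ₀ + t • h))]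
    exact integral_congr_ae (ae_of_all _ fun ω => by simp only [_root_.smul_apply, smul_eq_mul])
  -- the second-order tilted integral applied to `h, h`, at every point of the line
  have idS : ∀ t : ℝ, (∫ ω : EuclideanSpace ℝ ι, exp (-U (ω + (ψ₀ + t • h))) • (U'' (ω + (ψ₀ + t • h)) - (U' (ω + (ψ₀ + t • h))).smulRight (U' (ω + (ψ₀ + t • h))))
      ∂(multivariateGaussian 0 Γ)) h h =
      ∫ ω : EuclideanSpace ℝ ι, exp (-U (ω + (ψ₀ + t • h))) * (U'' (ω + (ψ₀ + t • h)) h h - U' (ω + (ψ₀ + t • h)) h * U' (ω + (ψ₀ + t • h)) h) ∂(multivariateGaussian 0 Γ)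
          := fun t => by
    have hHint := integrable_weightedBlockHess hΓ hΓop Y hUd hU'd hU''c hκ₀ hκ₁ ha hκ₂ hτ hδ hθ1 hκθ hstab hU'b hU''b (ψ₀ + t • h)
    rw [ContinuousLinearMap.integral_apply hHint, ContinuousLinearMap.integral_apply (by exact hHint.apply_continuousLinearMap h)]
    exact integral_congr_ae (ae_of_all _ fun ω => by
      simp only [_root_.smul_apply, _root_.sub_apply, smul_eq_mul, ContinuousLinearMap.smulRight_apply])
  refine ⟨?_, ?_, ?_, ?_⟩
  -- (0) integrability of the `Z‴` integrand: dominated at the centre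
  · refine (integrable_domination hΓ hΓop Y hκ₀ hτ hδ hθ1 hκθ
      (‖h‖ ^ 3 * exp (κ₀ * (1 + τ⁻¹) * (2 * ∑ x ∈ Y, (ψ₀ + t₀ • h) x ^ 2 + 2)) * (κ₁ ^ 3 * (4 * (a + 2 * (2 * ∑ x ∈ Y, (ψ₀ + t₀ • h) x ^ 2 + 2)) ^ 3 + 32 * (δ ^ 3)⁻¹) + 3 *
          κ₂ * κ₁ * ((a + 2 * (2 * ∑ x ∈ Y, (ψ₀ + t₀ • h) x ^ 2 + 2)) + δ⁻¹) + κ₃))).mono'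
      (continuous_F3 hUd hU'd hU''d hU₃c (ψ₀ + t₀ • h) h).aestronglyMeasurable (ae_of_all _ fun ω => ?_)
    exact (norm_F3_le hU''b hU₃b ω (ψ₀ + t₀ • h) h).trans (block_third_domination Y hκ₀ hκ₁ ha hκ₂ hκ₃ hτ hδ hstab hU'b
      (ψ₀ + t₀ • h) (ψ₀ + t₀ • h) (by rw [sub_self, norm_zero]; exact zero_le_one) ω h)
  -- (1) `Z′`: compose (402)'s derivative of the step with the line
  · have hZ := (hasFDerivAt_block_step hΓ hΓop Y hUd hU'c hκ₀ hκ₁ ha hτ hδ hθ0 hθ1 hκθ hstab hU'b (ψ₀ + t₀ • h)).comp_hasDerivAt t₀ (hℓ t₀)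
    have key : HasDerivAt (fun t : ℝ => ∫ ω : EuclideanSpace ℝ ι, exp (-U (ω + (ψ₀ + t • h))) ∂(multivariateGaussian 0 Γ))
        (-(∫ ω : EuclideanSpace ℝ ι, exp (-U (ω + (ψ₀ + t₀ • h))) • U' (ω + (ψ₀ + t₀ • h)) ∂(multivariateGaussian 0 Γ)) h) t₀ := hZ
    refine key.congr_deriv ?_
    rw [idG t₀, ← integral_neg]; exact integral_congr_ae (ae_of_all _ fun ω => (mul_neg _ _).symm)
  -- (2) `Z″`: compose (402)'s derivative of the tilted numerator with the line, apply to `h`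
  · have hN := (hasFDerivAt_block_tiltedNumerator hΓ hΓop Y hUd hU'd hU''c hκ₀ hκ₁ ha hκ₂ hτ hδ hθ1 hκθ hstab hU'b hU''b
      (ψ₀ + t₀ • h)).comp_hasDerivAt t₀ (hℓ t₀)
    have hN1 := (hN.clm_apply (hasDerivAt_const t₀ h)).fun_neg; rw [map_zero, add_zero] at hN1
    have key : HasDerivAt (fun t : ℝ => -((∫ ω : EuclideanSpace ℝ ι, exp (-U (ω + (ψ₀ + t • h))) • U' (ω + (ψ₀ + t • h)) ∂(multivariateGaussian 0 Γ)) h))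
        (-((∫ ω : EuclideanSpace ℝ ι, exp (-U (ω + (ψ₀ + t₀ • h))) • (U'' (ω + (ψ₀ + t₀ • h)) - (U' (ω + (ψ₀ + t₀ • h))).smulRight (U' (ω + (ψ₀ + t₀ • h))))
            ∂(multivariateGaussian 0 Γ)) h h)) t₀ := hN1
    have eN : (fun t : ℝ => -((∫ ω : EuclideanSpace ℝ ι, exp (-U (ω + (ψ₀ + t • h))) • U' (ω + (ψ₀ + t • h)) ∂(multivariateGaussian 0 Γ)) h)) =
        fun t : ℝ => ∫ ω : EuclideanSpace ℝ ι, exp (-U (ω + (ψ₀ + t • h))) * -(U' (ω + (ψ₀ + t • h)) h) ∂(multivariateGaussian 0 Γ) := funext fun t => by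
      rw [idG t, ← integral_neg]; exact integral_congr_ae (ae_of_all _ fun ω => (mul_neg _ _).symm)
    rw [eN] at key
    refine key.congr_deriv ?_
    rw [idS t₀, ← integral_neg]; exact integral_congr_ae (ae_of_all _ fun ω => by ring)
  -- (3) `Z‴`: one scalar dominated differentiation under the third block domination
  · have hρ : (0 : ℝ) < (1 + ‖h‖)⁻¹ := by positivity
    exact (hasDerivAt_integral_of_dominated_loc_of_deriv_le (μ := (multivariateGaussian 0 Γ)) (x₀ := t₀) (s := closedBall t₀ (1 + ‖h‖)⁻¹)
      (closedBall_mem_nhds t₀ hρ)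
      (Eventually.of_forall fun t => (continuous_F2 hUd hU'd hU''c (ψ₀ + t • h) h).aestronglyMeasurable)
      (integrable_F2 hΓ hΓop Y hUd hU'd hU''c hκ₀ hκ₁ ha hκ₂ hτ hδ hθ1 hκθ hstab hU'b hU''b (ψ₀ + t₀ • h) h)
      (continuous_F3 hUd hU'd hU''d hU₃c (ψ₀ + t₀ • h) h).aestronglyMeasurable
      (ae_of_all _ fun ω t ht => (norm_F3_le hU''b hU₃b ω (ψ₀ + t • h) h).trans
        (block_third_domination Y hκ₀ hκ₁ ha hκ₂ hκ₃ hτ hδ hstab hU'b (ψ₀ + t₀ • h) (ψ₀ + t • h) (line_ball_norm_le ψ₀ h ht) ω h))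
      (integrable_domination hΓ hΓop Y hκ₀ hτ hδ hθ1 hκθ _)
      (ae_of_all _ fun ω t _ => hasDerivAt_line_F2 hUd hU'd hU''d ω ψ₀ h t)).2

end Main

/-- Toy (§2): `2·S ≤ 1⁻¹e^{2·1·S}`. -/
example (S : ℝ) : 2 * S ≤ (1 : ℝ)⁻¹ * exp (2 * 1 * S) := lin_le_exp one_pos S

end Summit.QuantumFields.BalabanUV.T4Continuum.NE7b.SupBlockStepLineDerivatives
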